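import Mathlib.Probability.Martingale.Basic
import Mathlib.MeasureTheory.Integral.DominatedConvergence
import Mathlib.Topology.MetricSpace.ThickenedIndicator
import HarnessLib

/-!
# Martingales in the natural filtration from cylinder test functions

Topic `Probability/Process`; theorems only (plus the name `closedCylinder` for a generating
π-system). The **monotone-class form of the martingale property**: if `W` is a real process,
`𝓕 = Filtration.natural W` its (raw) natural filtration, and `X` is a real, integrable, strongly
`𝓕`-adapted process such that

`E[(X_t - X_s) · ψ(W_{S_0}, …, W_{S_{n-1}})] = 0`

for all `s ≤ t`, all finite families of times `S_k ≤ s` and all continuous `ψ : ℝⁿ → ℝ` with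
`|ψ| ≤ 1`, then `X` is an `𝓕`-martingale
(`Literature.Probability.Process.martingale_natural_of_integral_cylinder`). This is the form in
which the martingale property of a scaling limit is inherited from discrete martingales through
weak convergence (bounded continuous test functions of finitely many coordinates), e.g. in
Chelkak–Duminil-Copin–Hongler–Kemppainen–Smirnov, C. R. Math. 352 (2014), §3 ("`M_t(z)` … is a
martingale with respect to the filtration generated by `W_t`") and Duminil-Copin–Smirnov, Clay
Math. Proc. 15 (2012), proof of Prop. 6.7; it serves layer 5/6 of the decomposition of
crit-ising.S17 (`Literature.Probability.LatticeModels.convergesInLawToSLE_sixteen_thirds_fkInterface`).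

Proof: `𝓕_s` is generated by the π-system of finite intersections of closed cylinders
`W_j⁻¹(C)`, `j ≤ s`, `C` closed (`natural_eq_generateFrom_piiUnionInter`, Mathlib
`piiUnionInter`, `borel_eq_generateFrom_isClosed`, `comap_generateFrom`); on this π-system
`∫_A (X_t - X_s) = 0` by approximating indicators of closed sets by thickened indicators (Mathlib
`thickenedIndicator_tendsto_indicator_closure`) and dominated convergence
(`setIntegral_biInter_preimage_closed_eq_zero`); the sets `A ∈ 𝓕_s` with `∫_A (X_t - X_s) = 0`
form a Dynkin system (Mathlib `MeasurableSpace.induction_on_inter`); conclude with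
`ae_eq_condExp_of_forall_setIntegral_eq`. No path regularity and no usual conditions are involved.

## References

* D. Revuz, M. Yor, *Continuous Martingales and Brownian Motion* (3rd ed., 1999), Ch. II §1;
  Ch. 0 §1 (monotone class theorem).
* J.-F. Le Gall, *Brownian Motion, Martingales, and Stochastic Calculus* (2016), §3.3 and
  App. A1 (monotone class lemma).
* D. Chelkak, H. Duminil-Copin, C. Hongler, A. Kemppainen, S. Smirnov, C. R. Math. 352 (2014), §3.
-/

noncomputable section

open MeasureTheory Filter Topology Set
open scoped NNReal ENNReal

namespace Literature.Probability.Process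

variable {Ω : Type*} {m : MeasurableSpace Ω} {ι : Type*}

/-! ### The closed-cylinder π-system generating the natural filtration -/

/-- The **closed cylinders of one coordinate**: preimages `W_j⁻¹(C)` of closed sets `C ⊆ ℝ` under
the coordinate `W_j` of a real process. [folklore] -/
def closedCylinder (W : ι → Ω → ℝ) (j : ι) : Set (Set Ω) :=
  (fun C ↦ W j ⁻¹' C) '' {C : Set ℝ | IsClosed C}

/-- Closed cylinders of one coordinate form a π-system. [folklore] -/
theorem isPiSystem_closedCylinder (W : ι → Ω → ℝ) (j : ι) : IsPiSystem (closedCylinder W j) := by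
  rintro _ ⟨C, hC, rfl⟩ _ ⟨C', hC', rfl⟩ _
  exact ⟨C ∩ C', hC.inter hC', rfl⟩

/-- The σ-algebra generated by one coordinate is generated by its closed cylinders. [folklore] -/
theorem comap_eq_generateFrom_closedCylinder (W : ι → Ω → ℝ) (j : ι) :
    MeasurableSpace.comap (W j) (inferInstance : MeasurableSpace ℝ) =
      MeasurableSpace.generateFrom (closedCylinder W j) := by
  rw [BorelSpace.measurable_eq (α := ℝ), borel_eq_generateFrom_isClosed,
    MeasurableSpace.comap_generateFrom]
  rfl

/-- `generateFrom (piiUnionInter π S) = ⨆ i ∈ S, generateFrom (π i)`. [folklore] -/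
theorem generateFrom_piiUnionInter_eq (π : ι → Set (Set Ω)) (S : Set ι) :
    MeasurableSpace.generateFrom (piiUnionInter π S) =
      ⨆ i ∈ S, MeasurableSpace.generateFrom (π i) := by
  refine le_antisymm ?_ (iSup₂_le fun i hi ↦ le_generateFrom_piiUnionInter S hi)
  refine MeasurableSpace.generateFrom_le ?_
  rintro t ⟨F, hFS, f, hf, rfl⟩
  refine F.measurableSet_biInter fun x hx ↦ ?_
  have hle : MeasurableSpace.generateFrom (π x) ≤ ⨆ i ∈ S, MeasurableSpace.generateFrom (π i) :=
    le_iSup₂ (f := fun i (_ : i ∈ S) ↦ MeasurableSpace.generateFrom (π i)) x (hFS hx)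
  exact hle _ (MeasurableSpace.measurableSet_generateFrom (hf x hx))

variable [Preorder ι]

/-- **The natural filtration at time `s` is generated by the closed cylinders of the coordinates
`W_j`, `j ≤ s`** (finite intersections thereof form a generating π-system). [folklore] -/
theorem natural_eq_generateFrom_piiUnionInter (W : ι → Ω → ℝ) (hW : ∀ i, StronglyMeasurable (W i))
    (s : ι) :
    (Filtration.natural W hW) s =
      MeasurableSpace.generateFrom (piiUnionInter (closedCylinder W) {j | j ≤ s}) := by
  rw [generateFrom_piiUnionInter_eq]
  change (⨆ j ≤ s, MeasurableSpace.comap (W j) (inferInstance : MeasurableSpace ℝ)) = _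
  simp_rw [comap_eq_generateFrom_closedCylinder]
  rfl

/-! ### From the cylinder test-function identity to the martingale property -/

variable {P : Measure Ω}

omit [Preorder ι] in
/-- **The basic case of the monotone-class argument.** If `D` is integrable and
`∫ D · ψ(W_{S •}) = 0` for all continuous cylinder functions `|ψ| ≤ 1` based on finitely many
coordinates taken from a finite set `F` of indices, then `∫_{⋂_{x ∈ F} W_x⁻¹(C_x)} D = 0` for
closed sets `C_x`: the indicator of the intersection is the pointwise limit of the products of
thickened indicators `∏_x θ_k(W_x)`, `0 ≤ θ_k ≤ 1` continuous (Mathlib `thickenedIndicator`), and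
dominated convergence applies. Le Gall (2016), App. A1. [folklore] -/
theorem setIntegral_biInter_preimage_closed_eq_zero {W : ι → Ω → ℝ}
    (hW : ∀ i, StronglyMeasurable (W i)) {D : Ω → ℝ} (hD : Integrable D P) (F : Finset ι)
    (C : ι → Set ℝ) (hC : ∀ x ∈ F, IsClosed (C x))
    (h : ∀ (n : ℕ) (S : Fin n → ι), (∀ k, S k ∈ F) →
      ∀ (ψ : (Fin n → ℝ) → ℝ), Continuous ψ → (∀ v, |ψ v| ≤ 1) →
        ∫ ω, D ω * ψ (fun k ↦ W (S k) ω) ∂P = 0) :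
    ∫ ω in ⋂ x ∈ F, W x ⁻¹' C x, D ω ∂P = 0 := by
  classical
  set A : Set Ω := ⋂ x ∈ F, W x ⁻¹' C x with hA
  have hAm : MeasurableSet A := F.measurableSet_biInter fun x hx ↦
    (hW x).measurable (hC x hx).measurableSet
  -- thickened indicators
  set δ : ℕ → ℝ := fun k ↦ 1 / ((k : ℝ) + 1) with hδ
  have hδpos : ∀ k, 0 < δ k := fun k ↦ by rw [hδ]; positivity
  have hδlim : Tendsto δ atTop (𝓝 0) := tendsto_one_div_add_atTop_nhds_zero_nat
  set θ : ℕ → ι → ℝ → ℝ := fun k x r ↦ ((thickenedIndicator (hδpos k) (C x) r : ℝ≥0) : ℝ) with hθ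
  have hθc : ∀ k x, Continuous (θ k x) := fun k x ↦
    NNReal.continuous_coe.comp (thickenedIndicator (hδpos k) (C x)).continuous
  have hθ0 : ∀ k x r, 0 ≤ θ k x r := fun k x r ↦ NNReal.coe_nonneg _
  have hθ1 : ∀ k x r, θ k x r ≤ 1 := fun k x r ↦ by
    have := thickenedIndicator_le_one (hδpos k) (C x) r
    exact_mod_cast this
  have hθlim : ∀ x ∈ F, ∀ r, Tendsto (fun k ↦ θ k x r) atTop
      (𝓝 (indicator (C x) (fun _ ↦ (1 : ℝ)) r)) := by
    intro x hx r
    have h1 := thickenedIndicator_tendsto_indicator_closure hδpos hδlim (C x)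
    rw [tendsto_pi_nhds] at h1
    have h2 : Tendsto (fun k ↦ θ k x r) atTop
        (𝓝 (((indicator (closure (C x)) (fun _ ↦ (1 : ℝ≥0)) r : ℝ≥0) : ℝ))) :=
      (NNReal.continuous_coe.tendsto _).comp (h1 r)
    have h3 : (((indicator (closure (C x)) (fun _ ↦ (1 : ℝ≥0)) r : ℝ≥0) : ℝ)) =
        indicator (C x) (fun _ ↦ (1 : ℝ)) r := by
      rw [(hC x hx).closure_eq]
      by_cases hr : r ∈ C x
      · rw [indicator_of_mem hr, indicator_of_mem hr, NNReal.coe_one]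
      · rw [indicator_of_notMem hr, indicator_of_notMem hr, NNReal.coe_zero]
    rwa [h3] at h2
  -- the approximating products
  set Φ : ℕ → Ω → ℝ := fun k ω ↦ ∏ x ∈ F, θ k x (W x ω) with hΦ
  have hΦ0 : ∀ k ω, 0 ≤ Φ k ω := fun k ω ↦ Finset.prod_nonneg fun x _ ↦ hθ0 k x _
  have hΦ1 : ∀ k ω, Φ k ω ≤ 1 := fun k ω ↦ Finset.prod_le_one (fun x _ ↦ hθ0 k x _) fun x _ ↦ hθ1 k x _
  have hΦm : ∀ k, Measurable (Φ k) := fun k ↦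
    Finset.measurable_prod _ fun x _ ↦ (hθc k x).measurable.comp (hW x).measurable
  have hΦlim : ∀ ω, Tendsto (fun k ↦ Φ k ω) atTop (𝓝 (indicator A (fun _ ↦ (1 : ℝ)) ω)) := by
    intro ω
    have h1 : Tendsto (fun k ↦ Φ k ω) atTop
        (𝓝 (∏ x ∈ F, indicator (C x) (fun _ ↦ (1 : ℝ)) (W x ω))) :=
      tendsto_finsetProd F fun x hx ↦ hθlim x hx (W x ω)
    convert h1 using 2
    by_cases hω : ω ∈ A
    · rw [indicator_of_mem hω]
      refine (Finset.prod_eq_one fun x hx ↦ ?_).symm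
      have : W x ω ∈ C x := by
        have := mem_iInter₂.1 hω x hx
        exact this
      rw [indicator_of_mem this]
    · rw [indicator_of_notMem hω]
      have : ∃ x ∈ F, W x ω ∉ C x := by
        by_contra hcon
        push Not at hcon
        exact hω (mem_iInter₂.2 fun x hx ↦ hcon x hx)
      obtain ⟨x, hx, hxC⟩ := this
      exact (Finset.prod_eq_zero hx (by rw [indicator_of_notMem hxC])).symm
  -- each approximant integrates to zero against `D`
  have hzero : ∀ k, ∫ ω, D ω * Φ k ω ∂P = 0 := by
    intro k
    set n := F.card with hn
    set e := F.equivFin with he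
    set S : Fin n → ι := fun i ↦ ((e.symm i : F) : ι) with hS
    have hSF : ∀ i, S i ∈ F := fun i ↦ (e.symm i).2
    set ψ : (Fin n → ℝ) → ℝ := fun v ↦ ∏ i : Fin n, θ k (S i) (v i) with hψ
    have hψc : Continuous ψ :=
      continuous_finsetProd _ fun i _ ↦ (hθc k (S i)).comp (continuous_apply i)
    have hψ1 : ∀ v, |ψ v| ≤ 1 := fun v ↦ by
      rw [abs_of_nonneg (Finset.prod_nonneg fun i _ ↦ hθ0 k _ _)]
      exact Finset.prod_le_one (fun i _ ↦ hθ0 k _ _) fun i _ ↦ hθ1 k _ _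
    have hψΦ : ∀ ω, ψ (fun i ↦ W (S i) ω) = Φ k ω := by
      intro ω
      simp only [hψ, hΦ, hS]
      rw [← Finset.prod_coe_sort F (fun x ↦ θ k x (W x ω))]
      exact e.symm.prod_comp (fun x : F ↦ θ k (x : ι) (W (x : ι) ω))
    have := h n S hSF ψ hψc hψ1
    simpa only [hψΦ] using this
  -- dominated convergence
  have hlim : Tendsto (fun k ↦ ∫ ω, D ω * Φ k ω ∂P) atTop
      (𝓝 (∫ ω, D ω * indicator A (fun _ ↦ (1 : ℝ)) ω ∂P)) := by
    refine tendsto_integral_of_dominated_convergence (fun ω ↦ |D ω|)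
      (fun k ↦ (hD.aestronglyMeasurable.mul (hΦm k).aestronglyMeasurable)) hD.abs
      (fun k ↦ ae_of_all _ fun ω ↦ ?_) (ae_of_all _ fun ω ↦ (hΦlim ω).const_mul (D ω))
    rw [Real.norm_eq_abs, abs_mul, abs_of_nonneg (hΦ0 k ω)]
    exact mul_le_of_le_one_right (abs_nonneg _) (hΦ1 k ω)
  have hconst : Tendsto (fun k ↦ ∫ ω, D ω * Φ k ω ∂P) atTop (𝓝 0) := by
    simp only [hzero]; exact tendsto_const_nhds
  have heq := tendsto_nhds_unique hlim hconst
  have hind : (fun ω ↦ D ω * indicator A (fun _ ↦ (1 : ℝ)) ω) = indicator A D := by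
    funext ω
    by_cases hω : ω ∈ A <;> simp [hω]
  rw [hind, integral_indicator hAm] at heq
  exact heq

/-- **Martingales in the natural filtration from cylinder test functions.** Let `W` be a real
process with strongly measurable coordinates, `𝓕 = Filtration.natural W` its natural filtration,
and `X` a real process which is strongly `𝓕`-adapted and integrable. If for all `s ≤ t`, all
finite families of times `S k ≤ s` (`k < n`) and all bounded continuous `ψ : ℝⁿ → ℝ`,
`E[(X_t - X_s) ψ(W_{S_0}, …, W_{S_{n-1}})] = 0`, then `X` is an `𝓕`-martingale. Proof: by a
monotone-class (π-λ) argument over the π-system of finite intersections of closed cylinders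
`W_j⁻¹(C)`, `j ≤ s`, which generates `𝓕_s`; on the π-system the identity follows by approximating
indicators of closed sets by thickened indicators (dominated convergence), and the class of
`A ∈ 𝓕_s` with `∫_A (X_t - X_s) = 0` is a Dynkin system. This is the form in which the martingale
property of scaling limits is obtained from discrete martingales and weak convergence (e.g.
CDHKS 2014, §3; Duminil-Copin–Smirnov 2012, proof of Prop. 6.7). Revuz–Yor (1999), Ch. II §1;
Le Gall (2016), §3.3 (martingale property tested on a generating π-system). [folklore] -/
theorem martingale_natural_of_integral_cylinder [IsFiniteMeasure P] {W : ι → Ω → ℝ}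
    (hW : ∀ i, StronglyMeasurable (W i)) {X : ι → Ω → ℝ}
    (hXad : StronglyAdapted (Filtration.natural W hW) X) (hXint : ∀ i, Integrable (X i) P)
    (h : ∀ s t, s ≤ t → ∀ (n : ℕ) (S : Fin n → ι), (∀ k, S k ≤ s) →
      ∀ (ψ : (Fin n → ℝ) → ℝ), Continuous ψ → (∀ v, |ψ v| ≤ 1) →
        ∫ ω, (X t ω - X s ω) * ψ (fun k ↦ W (S k) ω) ∂P = 0) :
    Martingale X (Filtration.natural W hW) P := by
  set 𝓕 := Filtration.natural W hW with h𝓕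
  refine ⟨hXad, fun s t hst ↦ ?_⟩
  have hD : Integrable (fun ω ↦ X t ω - X s ω) P := (hXint t).sub (hXint s)
  -- the whole-space identity (`n = 0`, `ψ ≡ 1`)
  have hΩ : ∫ ω, (X t ω - X s ω) ∂P = 0 := by
    have := h s t hst 0 Fin.elim0 (fun k ↦ Fin.elim0 k) (fun _ ↦ 1) continuous_const
      (fun _ ↦ by simp)
    simpa using this
  -- the key identity on `𝓕 s`
  have key : ∀ A, MeasurableSet[𝓕 s] A → ∫ ω in A, (X t ω - X s ω) ∂P = 0 := by
    intro A hA
    induction A, hA using MeasurableSpace.induction_on_inter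
      (natural_eq_generateFrom_piiUnionInter W hW s)
      (isPiSystem_piiUnionInter _ (isPiSystem_closedCylinder W) _) with
    | empty => simp
    | basic A hA =>
      obtain ⟨F, hFS, f, hf, rfl⟩ := hA
      have hf' : ∀ x ∈ F, ∃ C : Set ℝ, IsClosed C ∧ W x ⁻¹' C = f x := fun x hx ↦ by
        simpa [closedCylinder] using hf x hx
      choose! C hCc hCeq using hf'
      have hAeq : (⋂ x ∈ F, f x) = ⋂ x ∈ F, W x ⁻¹' C x :=
        iInter₂_congr fun x hx ↦ (hCeq x hx).symm
      rw [hAeq]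
      refine setIntegral_biInter_preimage_closed_eq_zero hW hD F C hCc fun n S hS ψ hψc hψ1 ↦ ?_
      exact h s t hst n S (fun k ↦ hFS (hS k)) ψ hψc hψ1
    | compl A hAm hA =>
      have hAm' : MeasurableSet A := 𝓕.le s _ hAm
      have hsplit := integral_add_compl hAm' hD
      rw [hA, zero_add, hΩ] at hsplit
      exact hsplit
    | iUnion f hdisj hfm hf =>
      rw [integral_iUnion (fun i ↦ 𝓕.le s _ (hfm i)) hdisj hD.integrableOn]
      simp [hf]
  refine (ae_eq_condExp_of_forall_setIntegral_eq (𝓕.le s) (hXint t)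
    (fun A _ _ ↦ (hXint s).integrableOn) (fun A hA _ ↦ ?_) (hXad s).aestronglyMeasurable).symm
  have h0 := key A hA
  rw [integral_sub (hXint t).integrableOn (hXint s).integrableOn, sub_eq_zero] at h0
  exact h0.symm

end Literature.Probability.Process
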